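import Summits.BirchSwinnertonDyer.BirchSwinnertonDyer.Theorems.CyclotomicUntwistCompanionShapeTransport
import HarnessLib

/-!
# The factorization type of `Ψ₃` over `K` is an invariant of the `Γ_K`-module `E[3]`
# (route `CyclotomicUntwist` seat `bsd-line-cycu-p2` g5, O6 lane V10 — step (1) of the census law
# L-k3 `Cruxes/PSRankOneLowerHalfAtThree/LAW-Lk3-SERRE-WEIGHT-v1.md`; THEOREMS ONLY)

`…CompanionShapeTransport.lean` (M1) transports the `K`-RATIONAL roots of `Ψ₃` (the `Γ_K`-stable
lines) along a `Γ_K`-equivariant `f : V[3] ≃+ V'[3]`. This file transports ALL roots in `K̄`: the map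
"line ↦ abscissa" identifies the `Γ_K`-SET of the four lines of `V[3]` with the `Γ_K`-set of the
`K̄`-roots of `Ψ₃(V)`, so along `f`

* `exists_root_forall_smul_iff` — every `K̄`-root `r` of `Ψ₃(V)` has a partner root `r'` of `Ψ₃(V')`
  with the SAME stabiliser in `Γ_K`;
* `adjoin_eq_of_forall_smul_iff` — hence the same abscissa field `K(r) = K(r') ⊆ K̄` (infinite Galois
  theory, `InfiniteGalois.fixedField_fixingSubgroup`) and the same degree `[K(r) : K]`;
* **`exists_irreducible_factor_iff_of_equivariant`** — `Ψ₃(V)` has an irreducible factor of degree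
  `d` over `K` iff `Ψ₃(V')` does: the factorization type of `Ψ₃` (the census's basic local datum at
  `K = ℚ₃`: `[4]`, `[1,3]`, `[2,2]`, `[1,1,2]`, …) is an invariant of the Galois MODULE `E[3]`.

At `K = ℚ₃` the cubic factor of a one-stable-line curve is the abscissa field of the three
non-stable lines, whose ramification (très / peu ramifié) is the content of LAW L-k3; this file is its
module-invariance half. HONEST FRAMING: helper theorems over an arbitrary characteristic-`0` field;
nothing about any particular curve is asserted; BSD is not proved for any curve. References:
[Serre1972] §1.11; [Cremona1997] §3.8; [SilvermanAEC2009] III.§7, VIII.§1.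
-/

set_option linter.dupNamespace false

noncomputable section

open scoped Classical IntermediateField

universe u

namespace Summit.BirchSwinnertonDyer.BirchSwinnertonDyer.Theorems.CompanionShape

open Polynomial Field WeierstrassCurve Literature.NumberTheory.EllipticCurves

variable {K : Type u} [Field K] [CharZero K]

/-! ## §1 Every `K̄`-root of `Ψ₃` is the abscissa of a line of `V[3]` -/

section Lines

variable (V : WeierstrassCurve K) [V.IsElliptic]

omit [CharZero K] in
/-- A `K̄`-root `x` of `Ψ₃` carries a point `(x, y) ∈ V[3]` (the root is not a root of `Ψ₂²` on an
elliptic curve, so the point is not `2`-torsion and `3P = O`). [cite: SilvermanAEC2009, Exercise 3.7] -/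
theorem exists_some_mem_geomTorsion_of_eval_Ψ₃ {x : AlgebraicClosure K}
    (hΨ : (V.baseChange (AlgebraicClosure K)).Ψ₃.eval x = 0) :
    ∃ (y : AlgebraicClosure K) (h : (V.baseChange (AlgebraicClosure K)).toAffine.Nonsingular x y),
      (Affine.Point.some x y h : geomPoints V) ∈ geomTorsion V (3 : ℤ) := by
  set V' := V.baseChange (AlgebraicClosure K) with hV'
  obtain ⟨y, hxy⟩ := V'.exists_equation x
  have hns : V'.toAffine.Nonsingular x y := (Affine.equation_iff_nonsingular (W := V'.toAffine)).mp hxy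
  have hΔ : V'.Δ ≠ 0 := V'.coe_Δ' ▸ V'.Δ'.ne_zero
  have hy : y ≠ V'.toAffine.negY x y := by
    intro hneg
    apply V'.eval_Ψ₂Sq_ne_zero_of_eval_Ψ₃_eq_zero hΔ hΨ
    have hsq := V'.evalEval_ψ_sq hxy 2
    rw [ΨSq_two, ψ_two, ψ₂, Affine.evalEval_polynomialY] at hsq
    have h0 : 2 * y + V'.a₁ * x + V'.a₃ = 0 := by
      rw [Affine.negY] at hneg
      linear_combination hneg
    rw [← hsq]
    have : (2 * y + V'.toAffine.a₁ * x + V'.toAffine.a₃) = 0 := h0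
    rw [this]
    ring
  refine ⟨y, hns, ?_⟩
  have h3 : (3 : ℤ) • (Affine.Point.some x y hns : V'.toAffine.Point) = 0 := by
    refine (three_smul_some_eq_zero_iff hns hy).mpr ?_
    rw [ψ_three, evalEval_C]
    exact hΨ
  exact (Literature.NumberTheory.EllipticCurves.mem_torsionBy_iff).mpr h3

omit [CharZero K] [V.IsElliptic] in
/-- If `σT = ±T` then `σ` fixes the abscissa of `T`. [cite: SilvermanAEC2009, III.2.3] -/
theorem smul_X_eq_of_smul_eq_self_or_eq_neg {T : geomTorsion V (3 : ℤ)} {x y : AlgebraicClosure K}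
    {h : (V.baseChange (AlgebraicClosure K)).toAffine.Nonsingular x y}
    (hT : (T : geomPoints V) = Affine.Point.some x y h) {σ : absoluteGaloisGroup K}
    (hσ : σ • T = T ∨ σ • T = -T) : σ • x = x := by
  let τ : AlgebraicClosure K ≃ₐ[K] AlgebraicClosure K := σ
  show τ x = x
  rcases hσ with hσ | hσ
  · have hσ' := congrArg Subtype.val hσ
    rw [Literature.NumberTheory.EllipticCurves.AddSubgroup.torsionBy.coe_smul, hT] at hσ'
    change Affine.Point.map (τ : AlgebraicClosure K →ₐ[K] AlgebraicClosure K)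
      (Affine.Point.some x y h) = Affine.Point.some x y h at hσ'
    rw [Affine.Point.map_some] at hσ'
    simpa only [Affine.Point.some.injEq, AlgEquiv.coe_toAlgHom] using (Affine.Point.some.inj hσ').1
  · have hσ' := congrArg Subtype.val hσ
    rw [Literature.NumberTheory.EllipticCurves.AddSubgroup.torsionBy.coe_smul, AddSubgroup.coe_neg,
      hT] at hσ'
    change Affine.Point.map (τ : AlgebraicClosure K →ₐ[K] AlgebraicClosure K)
      (Affine.Point.some x y h) = -Affine.Point.some x y h at hσ'
    rw [Affine.Point.map_some, Affine.Point.neg_some] at hσ'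
    simpa only [Affine.Point.some.injEq, AlgEquiv.coe_toAlgHom] using (Affine.Point.some.inj hσ').1

end Lines

/-! ## §2 Transport of all roots with their stabilisers -/

section Transport

variable (V V' : WeierstrassCurve K) [V.IsElliptic] [V'.IsElliptic]
  (f : geomTorsion V (3 : ℤ) ≃+ geomTorsion V' (3 : ℤ))
  (hf : ∀ (σ : absoluteGaloisGroup K) (P : geomTorsion V (3 : ℤ)), f (σ • P) = σ • f P)

omit [CharZero K] [V'.IsElliptic] in
include hf in
/-- **Every `K̄`-root of `Ψ₃(V)` has a partner `K̄`-root of `Ψ₃(V')` with the same stabiliser in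
`Γ_K`** (the line above `r` goes to the line above `r'`; `σ` fixes an abscissa iff it maps the line
to itself). [cite: Serre1972, §1.11] [cite: Cremona1997, §3.8 (l = 3)] -/
theorem exists_root_forall_smul_iff {r : AlgebraicClosure K}
    (hr : ((V.baseChange (AlgebraicClosure K)).Ψ₃).IsRoot r) :
    ∃ r' : AlgebraicClosure K, ((V'.baseChange (AlgebraicClosure K)).Ψ₃).IsRoot r' ∧
      ∀ σ : absoluteGaloisGroup K, (σ • r = r ↔ σ • r' = r') := by
  obtain ⟨y, h, hmem⟩ := exists_some_mem_geomTorsion_of_eval_Ψ₃ V hr.eq_zero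
  set T : geomTorsion V (3 : ℤ) := ⟨_, hmem⟩ with hTdef
  have hT : (T : geomPoints V) = Affine.Point.some r y h := rfl
  have hT0 : T ≠ 0 := fun h0 ↦ Affine.Point.some_ne_zero h (congrArg Subtype.val h0)
  have hT'0 : f T ≠ 0 := fun h0 ↦ hT0 (f.injective (by rw [h0, map_zero]))
  obtain ⟨x', y', h', hT'⟩ := exists_eq_some_of_ne_zero V' hT'0
  refine ⟨x', ?_, fun σ ↦ ⟨fun hσ ↦ ?_, fun hσ ↦ ?_⟩⟩
  · exact (V'.eval_divisionPolynomial_three_eq_zero_of_eq_some (T := f T) hT' : _)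
  · -- `σ r = r ⟹ σT = ±T ⟹ σ(fT) = ±fT ⟹ σ x' = x'`
    have hpm := smul_eq_self_or_eq_neg V hT σ hσ
    refine smul_X_eq_of_smul_eq_self_or_eq_neg V' hT' ?_
    rcases hpm with h1 | h1
    · exact Or.inl (by rw [← hf, h1])
    · exact Or.inr (by rw [← hf, h1, map_neg])
  · have hpm := smul_eq_self_or_eq_neg V' hT' σ hσ
    refine smul_X_eq_of_smul_eq_self_or_eq_neg V hT ?_
    rcases hpm with h1 | h1
    · exact Or.inl (f.injective (by rw [hf, h1]))
    · exact Or.inr (f.injective (by rw [hf, h1, map_neg]))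

end Transport

/-! ## §3 Same stabiliser ⟹ same abscissa field; the factorization type of `Ψ₃` -/

omit [CharZero K] in
/-- Elements of `K̄` with the same stabiliser in `Γ_K` generate the same subfield (`K` of
characteristic `0`: `K̄/K` is Galois and `K(r)` is the fixed field of its fixing subgroup).
[folklore] -/
theorem adjoin_eq_of_forall_smul_iff [CharZero K] {r r' : AlgebraicClosure K}
    (h : ∀ σ : absoluteGaloisGroup K, (σ • r = r ↔ σ • r' = r')) : K⟮r⟯ = K⟮r'⟯ := by
  haveI : IsGalois K (AlgebraicClosure K) := {}
  have key : ∀ {a b : AlgebraicClosure K}, (∀ σ : absoluteGaloisGroup K, σ • a = a → σ • b = b) →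
      K⟮b⟯ ≤ K⟮a⟯ := by
    intro a b hab
    rw [← InfiniteGalois.fixedField_fixingSubgroup K⟮a⟯, IntermediateField.adjoin_simple_le_iff,
      IntermediateField.mem_fixedField_iff]
    intro σ hσ
    have ha : σ • a = a := (IntermediateField.mem_fixingSubgroup_iff K⟮a⟯ σ).mp hσ a
      (IntermediateField.mem_adjoin_simple_self K a)
    exact hab σ ha
  exact le_antisymm (key fun σ hσ ↦ (h σ).mpr hσ) (key fun σ hσ ↦ (h σ).mp hσ)

omit [CharZero K] in
/-- … hence the same degree over `K`. [folklore] -/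
theorem natDegree_minpoly_eq_of_forall_smul_iff [CharZero K] {r r' : AlgebraicClosure K}
    (h : ∀ σ : absoluteGaloisGroup K, (σ • r = r ↔ σ • r' = r')) :
    (minpoly K r).natDegree = (minpoly K r').natDegree := by
  have hr : IsIntegral K r := Algebra.IsIntegral.isIntegral r
  have hr' : IsIntegral K r' := Algebra.IsIntegral.isIntegral r'
  rw [← IntermediateField.adjoin.finrank hr, ← IntermediateField.adjoin.finrank hr',
    adjoin_eq_of_forall_smul_iff h]

section FactorType

variable (V V' : WeierstrassCurve K) [V.IsElliptic] [V'.IsElliptic]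
  (f : geomTorsion V (3 : ℤ) ≃+ geomTorsion V' (3 : ℤ))
  (hf : ∀ (σ : absoluteGaloisGroup K) (P : geomTorsion V (3 : ℤ)), f (σ • P) = σ • f P)

omit [V'.IsElliptic] in
include hf in
/-- One direction of the factor-type invariance: an irreducible factor of degree `d` of `Ψ₃(V)`
yields one of `Ψ₃(V')` (the minimal polynomial of the partner root). [cite: Serre1972, §1.11] -/
theorem exists_irreducible_factor_of_equivariant {d : ℕ}
    (h : ∃ q : K[X], Irreducible q ∧ q.natDegree = d ∧ q ∣ V.Ψ₃) :
    ∃ q : K[X], Irreducible q ∧ q.natDegree = d ∧ q ∣ V'.Ψ₃ := by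
  obtain ⟨q, hq, hqd, hqdvd⟩ := h
  set L := AlgebraicClosure K
  -- a root `r ∈ K̄` of `q`, hence of `Ψ₃(V)`
  have hdeg : q.degree ≠ 0 := fun h0 ↦ by
    have := hq.natDegree_pos
    rw [Polynomial.degree_eq_natDegree hq.ne_zero] at h0
    exact absurd (by exact_mod_cast h0 : q.natDegree = 0) this.ne'
  obtain ⟨r, hr⟩ := IsAlgClosed.exists_aeval_eq_zero L q hdeg
  have hrΨ : ((V.baseChange L).Ψ₃).IsRoot r := by
    obtain ⟨c, hc⟩ := hqdvd
    rw [IsRoot.def, WeierstrassCurve.baseChange, map_Ψ₃, eval_map, ← aeval_def, hc, map_mul, hr,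
      zero_mul]
  -- its partner root `r'` and the common degree
  obtain ⟨r', hr', hstab⟩ := exists_root_forall_smul_iff V V' f hf hrΨ
  have hmin : minpoly K r = q * C q.leadingCoeff⁻¹ := (minpoly.eq_of_irreducible hq hr).symm
  have hdeg' : (minpoly K r').natDegree = d := by
    rw [← natDegree_minpoly_eq_of_forall_smul_iff hstab, hmin, natDegree_mul hq.ne_zero, natDegree_C,
      add_zero, hqd]
    exact C_ne_zero.mpr (inv_ne_zero (leadingCoeff_ne_zero.mpr hq.ne_zero))
  refine ⟨minpoly K r', minpoly.irreducible (Algebra.IsIntegral.isIntegral r'), hdeg', ?_⟩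
  apply minpoly.dvd
  rw [aeval_def, ← eval_map, ← map_Ψ₃]
  exact hr'

include hf in
/-- **The factorization type of `Ψ₃` is a module invariant**: along a `Γ_K`-equivariant
`V[3] ≃+ V'[3]`, `Ψ₃(V)` has an irreducible factor of degree `d` over `K` iff `Ψ₃(V')` does.
[cite: Serre1972, §1.11] [cite: Cremona1997, §3.8 (l = 3)] -/
theorem exists_irreducible_factor_iff_of_equivariant (d : ℕ) :
    (∃ q : K[X], Irreducible q ∧ q.natDegree = d ∧ q ∣ V.Ψ₃) ↔
      ∃ q : K[X], Irreducible q ∧ q.natDegree = d ∧ q ∣ V'.Ψ₃ :=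
  ⟨exists_irreducible_factor_of_equivariant V V' f hf,
    exists_irreducible_factor_of_equivariant V' V f.symm (equivariant_symm V V' f hf)⟩

end FactorType

end Summit.BirchSwinnertonDyer.BirchSwinnertonDyer.Theorems.CompanionShape

end
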